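import Literature.Topology.FourManifolds.TautFoliationsCollarRadial
import HarnessLib

/-!
# The coned collar squares have radial boundary heights — polar centre off the grid centre

Sibling of `TautFoliationsCollarRadial.lean` with the **polar centre `c₀` of the collar disc
decoupled from the centre `c₁` of the coned square** (needed to cone the collar disc on a square
whose grid is in general position with respect to the rings; see the fact seat's NOTES §50–§51):
`P : ConePosition F G c₁ hL₁` while `G` is the collar disc about `c₀` with outer radius `L`. The
outer-collar squares carry the two-sided radius bound `7L/8 ≤ dist x c₀ ≤ L` as a hypothesis.
Statements and proofs follow the concentric file.

* `ConePosition.radialHt'` (**definition**), `ConePosition.isRadial_bdryHt'` (**proved**).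

All statements are [folklore].
-/

noncomputable section

open Set Filter Metric Topology Function Real
open scoped unitInterval

namespace Literature.Topology.FourManifolds

/-! ## The radial boundary heights of the collar squares -/

namespace Foliation.ConePosition

open SquareGrid SquareGrid.Grid SquarePolar ConeSquare CollarRadius

variable {B : Type*} [NormedAddCommGroup B] [NormedSpace ℝ B] {M : Type*} [TopologicalSpace M] {F : Foliation B M}
variable {Γ : C(I, F.GermSpace)} {τ₀ ε : ℝ} {Φ : I → ℝ → M} {c₁ : ℝ × ℝ} {L₁ : ℝ} {hL₁ : 0 < L₁} {G : ℝ × ℝ → M}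
variable (P : ConePosition F G c₁ hL₁) {c₀ : ℝ × ℝ} {L : ℝ}

/-- **The radial height function of a square**: the `e_Q`-height of the collar disc at the point
of the ray from `c₀` through the centre of `Q` at distance `R`. [folklore] -/
def radialHt' (c₀ : ℝ × ℝ) (q : Fin P.n × Fin P.n) (R : ℝ) : ℝ := height (P.box q) (G (rayPt c₀ (P.gr.centre q) R))

section Radial

variable (hΦ : IsFenceOn F Γ τ₀ ε Φ univ) (hcl : ∀ τ ∈ Ioo (τ₀ - ε) (τ₀ + ε), Φ 1 τ = Φ 0 τ) {τ₁ : ℝ}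
  (hτI : uIcc τ₀ τ₁ ⊆ Ioo (τ₀ - ε) (τ₀ + ε)) (h01 : τ₁ ≠ τ₀)
  (hG : ∀ x, L / 2 ≤ dist x c₀ → G x = Φ (angleParam c₀ x) (levelOfParam τ₀ τ₁ (1 - dist x c₀ / L)))
  (hGc : Continuous G)
  (hL : 0 < L) {q : Fin P.n × Fin P.n} (hq : ∀ x ∈ P.gr.sq q, 7 * L / 8 ≤ dist x c₀ ∧ dist x c₀ ≤ L)
  (hskel : ∀ x ∈ sphere (P.gr.centre q) P.gr.ℓ, P.skel x = G x)

include hL hq in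
omit [NormedSpace ℝ B] in
/-- The centre of an outer-collar square is not `c₀`, and the radius range of the square. [folklore] -/
private theorem collar_radius_bounds' : P.gr.centre q ≠ c₀ ∧ 7 * L / 8 ≤ dist (P.gr.centre q) c₀ - P.gr.ℓ ∧
    dist (P.gr.centre q) c₀ + P.gr.ℓ ≤ L := by
  have hℓ := P.gr.hℓ
  set cq := P.gr.centre q with hcq
  have hcq0 : 7 * L / 8 ≤ dist cq c₀ := (hq cq (P.gr.centre_mem_sq q)).1
  have hne : cq ≠ c₀ := fun h ↦ by rw [h, dist_self] at hcq0; linarith [hL]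
  -- the nearest and farthest ray points of the square
  have hnear : rayPt c₀ cq (dist cq c₀ - P.gr.ℓ) ∈ P.gr.sq q := by
    show rayPt c₀ cq (dist cq c₀ - P.gr.ℓ) ∈ closedBall cq P.gr.ℓ
    rw [mem_closedBall, dist_rayPt_self hne, show dist cq c₀ - P.gr.ℓ - dist cq c₀ = -P.gr.ℓ by ring, abs_neg, abs_of_pos hℓ]
  have hfar : rayPt c₀ cq (dist cq c₀ + P.gr.ℓ) ∈ P.gr.sq q := by
    show rayPt c₀ cq (dist cq c₀ + P.gr.ℓ) ∈ closedBall cq P.gr.ℓ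
    rw [mem_closedBall, dist_rayPt_self hne, show dist cq c₀ + P.gr.ℓ - dist cq c₀ = P.gr.ℓ by ring, abs_of_pos hℓ]
  have hpos : 0 ≤ dist cq c₀ - P.gr.ℓ := by
    -- `ℓ ≤ 7L/8 ≤ dist cq c₀`? only `ℓ ≤ L`: use the near point when nonnegative, else trivial bound fails; argue directly
    by_contra h
    push Not at h
    -- then `c₀ ∈ sq q`, contradicting `hq`
    have hc₀ : c₀ ∈ P.gr.sq q := by
      show c₀ ∈ closedBall cq P.gr.ℓ
      rw [mem_closedBall, dist_comm]; linarith
    have := (hq c₀ hc₀).1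
    rw [dist_self] at this; linarith [hL]
  refine ⟨hne, ?_, ?_⟩
  · have h := (hq _ hnear).1
    rwa [dist_rayPt hne hpos] at h
  · have h := (hq _ hfar).2
    rwa [dist_rayPt hne (by linarith [hℓ])] at h

include hΦ hcl hτI hG hL hq in
omit [NormedSpace ℝ B] in
/-- **Two points of an outer-collar square at the same distance from `c₀` have the same height**
in the box of the square. [folklore] -/
private theorem height_eq_of_dist_eq' {x y : ℝ × ℝ} (hx : x ∈ P.gr.sq q) (hy : y ∈ P.gr.sq q) {R : ℝ}
    (hxR : dist x c₀ = R) (hyR : dist y c₀ = R) : height (P.box q) (G x) = height (P.box q) (G y) := by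
  have hℓ := P.gr.hℓ
  obtain ⟨hne, hlo, hhi⟩ := P.collar_radius_bounds' hL hq
  -- the connected set `C = sphere c₀ R ∩ sq q`
  set C : Set (ℝ × ℝ) := sphere c₀ R ∩ P.gr.sq q with hC
  have hRℓ : P.gr.ℓ < R := by
    have := (hq x hx).1; rw [hxR] at this
    have h2 : P.gr.ℓ ≤ dist (P.gr.centre q) c₀ - P.gr.ℓ - P.gr.ℓ + P.gr.ℓ := by linarith
    -- `ℓ < 7L/8 ≤ R` since `ℓ ≤ (dist - ℓ) ...`: from `hlo` and `hhi`, `2ℓ ≤ L - 7L/8`, so `ℓ ≤ L/16 < 7L/8 ≤ R`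
    nlinarith [hlo, hhi, this]
  have hCpre : IsPreconnected C := isPreconnected_bigSphere_inter_closedBall hℓ hRℓ
  haveI : PreconnectedSpace C := isPreconnected_iff_preconnectedSpace.1 hCpre
  -- `G` on `C` is the fence horizontal at the level of `R`, read through the angle: leafwise continuous
  have hRlo : L / 2 ≤ R := by rw [← hxR]; linarith [(hq x hx).1]
  have hτR : levelOfParam τ₀ τ₁ (1 - R / L) ∈ Ioo (τ₀ - ε) (τ₀ + ε) := hτI (levelOfParam_mem τ₀ τ₁ _)
  set g₀ : I → F.LeafSpace := toLeafSpace ∘ fun a ↦ Φ a (levelOfParam τ₀ τ₁ (1 - R / L)) with hg₀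
  have hg₀c : Continuous g₀ := hΦ.continuous_toLeafSpace hτR
  have hg₀01 : g₀ 0 = g₀ 1 := by
    show toLeafSpace (Φ 0 _) = toLeafSpace (Φ 1 _)
    rw [hcl _ hτR]
  have hGC : ∀ z ∈ C, G z = Φ (angleParam c₀ z) (levelOfParam τ₀ τ₁ (1 - R / L)) := fun z hz ↦ by
    rw [hG z (by rw [mem_sphere.1 hz.1]; exact hRlo), mem_sphere.1 hz.1]
  have hC0 : C ⊆ {c₀}ᶜ := fun z hz h ↦ by
    have := mem_sphere.1 hz.1
    rw [h, dist_self] at this; linarith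
  have hcontC : ContinuousOn (fun z ↦ (toLeafSpace (G z) : F.LeafSpace)) C := by
    refine ((continuousOn_comp_angleParam hg₀c hg₀01 c₀).mono hC0).congr fun z hz ↦ ?_
    show toLeafSpace (G z) = toLeafSpace (Φ (angleParam c₀ z) _)
    rw [hGC z hz]
  have hgC : Continuous fun k : C ↦ (toLeafSpace (G (k : ℝ × ℝ)) : F.LeafSpace) :=
    continuousOn_iff_continuous_restrict.1 hcontC
  have hsrcC : ∀ k : C, ofLeafSpace (toLeafSpace (G (k : ℝ × ℝ)) : F.LeafSpace) ∈ (P.box q).source := fun k ↦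
    F.subbox_subset_source (P.box_mem q) (P.apply_mem q q (P.gr.adj_refl q) _ k.2.2)
  have key := F.height_eq_of_leafwise (P.box_mem q) hgC hsrcC ⟨x, mem_sphere.2 hxR, hx⟩ ⟨y, mem_sphere.2 hyR, hy⟩
  exact key

include hΦ hcl hτI hG hL hq in
omit [NormedSpace ℝ B] in
/-- **The boundary heights of an outer-collar square are the radial heights.** [folklore] -/
theorem height_eq_radialHt' {x : ℝ × ℝ} (hx : x ∈ P.gr.sq q) : height (P.box q) (G x) = P.radialHt' c₀ q (dist x c₀) := by
  obtain ⟨hne, hlo, hhi⟩ := P.collar_radius_bounds' hL hq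
  have hℓ := P.gr.hℓ
  -- the ray point at the distance of `x` lies in the square
  have hR0 : 0 ≤ dist x c₀ := dist_nonneg
  have hmem : rayPt c₀ (P.gr.centre q) (dist x c₀) ∈ P.gr.sq q := by
    show rayPt c₀ (P.gr.centre q) (dist x c₀) ∈ closedBall (P.gr.centre q) P.gr.ℓ
    rw [mem_closedBall, dist_rayPt_self hne]
    have h := abs_dist_sub_le x (P.gr.centre q) c₀
    have hxq : dist x (P.gr.centre q) ≤ P.gr.ℓ := mem_closedBall.1 hx
    linarith
  exact P.height_eq_of_dist_eq' hΦ hcl hτI hG hL hq hx hmem rfl (dist_rayPt hne hR0)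

include hΦ hτI h01 hG hGc hL hq in
omit [NormedSpace ℝ B] in
/-- **The radial height function is strictly monotone on the radius range of the square.**
[folklore] -/
theorem strictMonoOn_or_strictAntiOn_radialHt' :
    StrictMonoOn (P.radialHt' c₀ q) (Icc (dist (P.gr.centre q) c₀ - P.gr.ℓ) (dist (P.gr.centre q) c₀ + P.gr.ℓ)) ∨
    StrictAntiOn (P.radialHt' c₀ q) (Icc (dist (P.gr.centre q) c₀ - P.gr.ℓ) (dist (P.gr.centre q) c₀ + P.gr.ℓ)) := by
  obtain ⟨hne, hlo, hhi⟩ := P.collar_radius_bounds' hL hq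
  have hℓ := P.gr.hℓ
  set cq := P.gr.centre q with hcq
  set a := dist cq c₀ - P.gr.ℓ with ha
  set b := dist cq c₀ + P.gr.ℓ with hb
  have hab : a ≤ b := by rw [ha, hb]; linarith
  have ha0 : 0 < a := by linarith [hL]
  -- ray points of radii in `[a, b]` are in the square
  have hmem : ∀ R ∈ Icc a b, rayPt c₀ cq R ∈ P.gr.sq q := fun R hR ↦ by
    show rayPt c₀ cq R ∈ closedBall cq P.gr.ℓ
    rw [mem_closedBall, dist_rayPt_self hne, abs_le]
    constructor <;> linarith [hR.1, hR.2]
  have hsrc : ∀ R ∈ Icc a b, G (rayPt c₀ cq R) ∈ (P.box q).source := fun R hR ↦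
    F.subbox_subset_source (P.box_mem q) (P.apply_mem q q (P.gr.adj_refl q) _ (hmem R hR))
  -- continuity on `[a, b]`
  have hcont : ContinuousOn (P.radialHt' c₀ q) (Icc a b) := by
    have h1 : Continuous fun R ↦ G (rayPt c₀ cq R) := hGc.comp (continuous_rayPt c₀ cq)
    have h2 : ContinuousOn (fun z ↦ height (P.box q) z) (P.box q).source := fun z hz ↦
      (continuous_snd.continuousAt.comp ((P.box q).continuousAt hz)).continuousWithinAt
    exact h2.comp h1.continuousOn hsrc
  refine strictMonoOn_or_strictAntiOn_of_locally_injOn hab hcont fun R₀ hR₀ ↦ ?_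
  -- the formula through the fence on the ray: constant angle parameter `a⋆`
  set astar : I := angleParam c₀ cq with hastar
  set τf : ℝ → ℝ := fun R ↦ levelOfParam τ₀ τ₁ (1 - R / L) with hτf
  have hform : ∀ R ∈ Icc a b, P.radialHt' c₀ q R = height (P.box q) (Φ astar (τf R)) := fun R hR ↦ by
    have hRpos : 0 < R := ha0.trans_le hR.1
    show height (P.box q) (G (rayPt c₀ cq R)) = _
    rw [hG _ (by rw [dist_rayPt hne hRpos.le]; linarith [hR.1]), dist_rayPt hne hRpos.le, angleParam_rayPt hne hRpos]
  -- the height germ at `(a⋆, τf R₀)`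
  have hτadm : ∀ R, τf R ∈ Ioo (τ₀ - ε) (τ₀ + ε) := fun R ↦ hτI (levelOfParam_mem τ₀ τ₁ _)
  have hsrc₀ : Φ astar (τf R₀) ∈ (P.box q).source := by
    have h := hsrc R₀ hR₀
    rwa [hG _ (by rw [dist_rayPt hne (ha0.trans_le hR₀.1).le]; linarith [hR₀.1]),
      dist_rayPt hne (ha0.trans_le hR₀.1).le, angleParam_rayPt hne (ha0.trans_le hR₀.1)] at h
  obtain ⟨χ, ⟨κ, hκ, -, hχmono⟩, hev⟩ := hΦ.exists_height_germ (P.box_mem q) (hτadm R₀) hsrc₀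
  -- pull back along `R ↦ (a⋆, τf R)`
  have hτc : Continuous τf := (continuous_levelOfParam τ₀ τ₁).comp (continuous_const.sub (continuous_id.div_const L))
  have hca : ContinuousAt (fun R ↦ ((astar, τf R) : I × ℝ)) R₀ := continuousAt_const.prodMk hτc.continuousAt
  have h1 : ∀ᶠ R in 𝓝 R₀, height (P.box q) (Φ astar (τf R)) = χ (τf R) := hca.eventually hev
  have h2 : ∀ᶠ R in 𝓝 R₀, τf R ∈ Ioo (τf R₀ - κ) (τf R₀ + κ) :=
    hτc.continuousAt.preimage_mem_nhds (Ioo_mem_nhds (by linarith) (by linarith))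
  obtain ⟨U, hU, hUsub⟩ : ∃ U ∈ 𝓝 R₀, ∀ R ∈ U, height (P.box q) (Φ astar (τf R)) = χ (τf R) ∧
      τf R ∈ Ioo (τf R₀ - κ) (τf R₀ + κ) := by
    obtain ⟨U, hU, h⟩ := (h1.and h2).exists_mem
    exact ⟨U, hU, h⟩
  refine ⟨U, hU, fun R hR R' hR' hRR' ↦ ?_⟩
  -- `τf` is affine injective on `[a, b]`, `χ` injective on the germ interval
  have hχinj : InjOn χ (Ioo (τf R₀ - κ) (τf R₀ + κ)) := hχmono.elim StrictMonoOn.injOn StrictAntiOn.injOn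
  rw [hform R hR.2, hform R' hR'.2, (hUsub R hR.1).1, (hUsub R' hR'.1).1] at hRR'
  have hτeq : τf R = τf R' := hχinj (hUsub R hR.1).2 (hUsub R' hR'.1).2 hRR'
  -- affine formula for `τf` on `[a, b] ⊆ [3L/4, L]`
  have haff : ∀ R'' ∈ Icc a b, τf R'' = τ₀ + (τ₁ - τ₀) * (4 * (1 - R'' / L)) := fun R'' hR'' ↦
    collarLevel_eq hL (by linarith [hR''.1]) (hR''.2.trans hhi)
  rw [haff R hR.2, haff R' hR'.2] at hτeq
  have h01' : τ₁ - τ₀ ≠ 0 := sub_ne_zero.2 h01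
  have : (1 - R / L) = (1 - R' / L) := by
    have h := mul_left_cancel₀ h01' (by linarith : (τ₁ - τ₀) * (4 * (1 - R / L)) = (τ₁ - τ₀) * (4 * (1 - R' / L)))
    linarith
  field_simp at this
  linarith

include hΦ hcl hτI h01 hG hGc hL hq hskel in
omit [NormedSpace ℝ B] in
/-- **The boundary heights of an outer-collar square are radial.** [folklore] -/
theorem isRadial_bdryHt' : ConeSquare.IsRadial c₀ (P.gr.centre q) P.gr.ℓ (P.bdryHt q) (P.radialHt' c₀ q)
    (Icc (dist (P.gr.centre q) c₀ - P.gr.ℓ) (dist (P.gr.centre q) c₀ + P.gr.ℓ)) where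
  eq x hx := by
    rw [P.bdryHt_apply, hskel x hx]
    exact P.height_eq_radialHt' hΦ hcl hτI hG hL hq (P.gr.sphere_subset_sq q hx)
  mem x hx := by
    have h := abs_dist_sub_le x (P.gr.centre q) c₀
    rw [mem_sphere.1 hx] at h
    rw [abs_le] at h
    exact ⟨by linarith [h.1], by linarith [h.2]⟩
  mono := P.strictMonoOn_or_strictAntiOn_radialHt' hΦ hτI h01 hG hGc hL hq

end Radial

end Foliation.ConePosition

end Literature.Topology.FourManifolds
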